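import Literature.AnabelianGeometry.SemiGraphs.CoveringBranchFrames
import Literature.AnabelianGeometry.SemiGraphs.BranchSubgroupLemmas
import Literature.AnabelianGeometry.Anabelioids.ComponentsTransitive
import HarnessLib

/-!
# Branch alignment (ii): distinct branches over `b` give distinct components of `A_e` ([SemiAnbd] §2)

Mochizuki, *Semi-graphs of anabelioids*, Publ. RIMS **42** (2006) 221–322, §2: Def. 2.2 (i) p. 23
(the covering attached to `A ∈ B(𝒢)`: "the edges `e′` of `𝒢′` are the connected components of
`B′ ×_B 𝒢_e`", a branch `b′` of `e′` at `v′` lying over `b` placing the component of `A_e` labelled by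
`e′` under `b^*` of the component of `A_v` labelled by `v′`) and Rem. 2.4.2 p. 26 (the 2-cells `φ_b`)
[cite: MochizukiSemiAnbd2006, Def. 2.2(i) p.23].

PROOF-ONLY (abc-iut cell, layer L3; FACT-LIST rows F-1478/F-1487, the (TIE) junction of
abc-iut-f-161's `HOME/staging/f/f-161/J1-TIE-ROUTE.md`, brick **(T-β)**; seat abc-iut-f-160).  Clause
(ii) of abc-iut-L4-t17's `Hom.IsBranchAligned` says that for two DISTINCT branches `b′₁ ≠ b′₂` at `v′`
over the same `b`, the transport element `t = α₂⁻¹ ≫ b^*θ ≫ α₁ ∈ Π_v` lies outside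
`Π_{b,1}^{al} · ι(Π_{v′})`.  Read on the fibre of `A_e`, this is exactly the statement that the two
edge base points obtained from the GLOBAL base point `x ∈ F(A_v)` (whose stabiliser is `ι(Π_{v′})`,
vertex alignment) through the two aligned frames land in DIFFERENT `Π_e`-orbits, i.e. (components =
orbits, `Anabelioids.range_map_arrow_eq_orbit`) on different connected components of `A_e`:

* `smul_frame_point_eq_iff` — frame bookkeeping (pure): for frames `αᵢ : b^* ⋙ F_{e,i} ≅ F`, a gluing
  `ψ : b^* X ≅ Y`, `θ : F_{e,2} ≅ F_{e,1}` and `x ∈ F(X)`, with `yᵢ := F_{e,i}(ψ)(αᵢ⁻¹ x)`: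
  `γ • θ_Y(y₂) = y₁ ↔ (Aut(α₁)(π₁(b^*) γ) * t) • x = x`;
* `not_mem_orbit_of_transport` — hence if `Stab(x) = ι(Π_{v′})`-shaped and `t ∉ range(k₁) · Stab(x)`
  then `θ_Y(y₂) ∉ Aut F_{e,1} · y₁`;
* **`Hom.IsBranchAligned.edgePoint_not_mem_orbit`** / **`…component_ne_of_branch_ne`** — for `φ`
  branch-aligned, `b′₁ ≠ b′₂` at `v′` over `b`, and `x ∈ F(A_v)` with `Stab_{Π_v}(x) = ι(Π_{v′})`
  (the global base point; abc-iut-w4-d079 `IsVertexAligned.stabilizer_eq_of_ranges`): the edge points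
  `x^e(b′ᵢ) := F_{e,i}(ψ_b^A)(alignIsoᵢ⁻¹ x)` (abc-iut-f-161's `EdgeAlignedStabilizers`) lie, after any
  identification `θ` of the two edge basepoints, in different `Π_e`-orbits, hence the connected
  components of `A_e` through them are different objects of `π₀(A_e)`.

No definition; nothing here takes a side on [IUTchIII] Cor. 3.12; typed ≠ proved for F-1478/F-1487.
-/

namespace Literature.AnabelianGeometry.SemiGraphs

open CategoryTheory CategoryTheory.Limits CategoryTheory.PreGaloisCategory
open Literature.AnabelianGeometry.Anabelioids
open scoped Pointwise

universe w v₁ u₁ u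

/-! ### Part A. Two frames, one gluing: where the transport element acts -/

section Frame

variable {C : Type*} [Category C] {D : Type*} [Category D] (b : C ⥤ D)
  {Fe₁ Fe₂ : D ⥤ FintypeCat.{w}} {F : C ⥤ FintypeCat.{w}}
  (α₁ : b ⋙ Fe₁ ≅ F) (α₂ : b ⋙ Fe₂ ≅ F) (θ : Fe₂ ≅ Fe₁)

/-- **Frame bookkeeping.**  For two frames `αᵢ : b^* ⋙ F_{e,i} ≅ F`, an identification `θ : F_{e,2} ≅
F_{e,1}`, a gluing `ψ : b^* X ≅ Y` and `x ∈ F(X)`, put `yᵢ := F_{e,i}(ψ)(αᵢ⁻¹_X x)` and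
`t := α₂⁻¹ ≫ b^*θ ≫ α₁ ∈ Aut F`.  Then for `γ ∈ Aut F_{e,1}`:
`γ • θ_Y(y₂) = y₁ ↔ (Aut(α₁)(π₁(b^*) γ) * t) • x = x`. [cite: MochizukiSemiAnbd2006, Rem. 2.4.2 p.26] -/
theorem smul_frame_point_eq_iff [Fe₁.PreservesMonomorphisms] {X : C} {Y : D} (ψ : b.obj X ≅ Y)
    (x : F.obj X) (γ : Aut Fe₁) :
    γ • θ.hom.app Y (Fe₂.map ψ.hom (α₂.inv.app X x)) = Fe₁.map ψ.hom (α₁.inv.app X x) ↔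
      ((Aut.autMulEquivOfIso α₁ (pi1Map b Fe₁ γ)) *
          SemiGraphOfAnabelioids.transportAut α₂ (Functor.isoWhiskerLeft b θ ≪≫ α₁)) • x = x := by
  have h0 : ∀ z : F.obj X, α₁.hom.app X (α₁.inv.app X z) = z := fun z => by
    rw [← FintypeCat.comp_apply, Iso.inv_hom_id_app, FintypeCat.id_apply]
  have h0' : ∀ z : Fe₁.obj (b.obj X), α₁.inv.app X (α₁.hom.app X z) = z := fun z => by
    rw [← FintypeCat.comp_apply, Iso.hom_inv_id_app]
    rfl
  -- the right-hand side unfolded: `α₁(γ(θ(α₂⁻¹ x))) = x`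
  have hR : ((Aut.autMulEquivOfIso α₁ (pi1Map b Fe₁ γ)) *
        SemiGraphOfAnabelioids.transportAut α₂ (Functor.isoWhiskerLeft b θ ≪≫ α₁)) • x =
      α₁.hom.app X (γ.hom.app (b.obj X) (θ.hom.app (b.obj X) (α₂.inv.app X x))) := by
    rw [mul_smul, mulAction_def, mulAction_def]
    change (α₁.inv.app X ≫ (pi1Map b Fe₁ γ).hom.app X ≫ α₁.hom.app X)
        ((α₂.inv.app X ≫ θ.hom.app (b.obj X) ≫ α₁.hom.app X) x) = _
    simp only [FintypeCat.comp_apply, pi1Map_hom_app]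
    exact congrArg _ (congrArg _ (h0' _))
  -- the left-hand side unfolded: `F_{e,1}(ψ)(γ(θ(α₂⁻¹ x))) = F_{e,1}(ψ)(α₁⁻¹ x)`
  have hL : γ • θ.hom.app Y (Fe₂.map ψ.hom (α₂.inv.app X x)) =
      Fe₁.map ψ.hom (γ.hom.app (b.obj X) (θ.hom.app (b.obj X) (α₂.inv.app X x))) := by
    rw [mulAction_def, ← FunctorToFintypeCat.naturality, ← FunctorToFintypeCat.naturality]
  rw [hR, hL]
  haveI : Mono (Fe₁.map ψ.hom) := inferInstance
  have hinj : Function.Injective (Fe₁.map ψ.hom) :=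
    ConcreteCategory.injective_of_mono_of_preservesPullback _
  constructor
  · intro h
    rw [hinj h, h0]
  · intro h
    have h1 := congrArg (α₁.inv.app X) h
    rw [h0'] at h1
    rw [h1]

/-- **The transport element decides the orbit.**  In the situation of `smul_frame_point_eq_iff`, if
`t ∉ range(Aut(α₁) ∘ π₁(b^*)) · Stab(x)` — spelled `t ≠ β * s` for `β` in the range and `s ∈ Stab(x)` —
then `θ_Y(y₂)` is NOT in the `Aut F_{e,1}`-orbit of `y₁`. [cite: MochizukiSemiAnbd2006, Rem. 2.4.2 p.26] -/
theorem not_mem_orbit_of_transport [Fe₁.PreservesMonomorphisms] {X : C} {Y : D} (ψ : b.obj X ≅ Y)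
    (x : F.obj X)
    (ht : ∀ (β : Aut F), β ∈ ((Aut.autMulEquivOfIso α₁).toMonoidHom.comp (pi1Map b Fe₁)).range →
      ∀ s ∈ MulAction.stabilizer (Aut F) x,
        SemiGraphOfAnabelioids.transportAut α₂ (Functor.isoWhiskerLeft b θ ≪≫ α₁) ≠ β * s) :
    θ.hom.app Y (Fe₂.map ψ.hom (α₂.inv.app X x)) ∉
      MulAction.orbit (Aut Fe₁) (Fe₁.map ψ.hom (α₁.inv.app X x)) := by
  rintro ⟨γ, hγ⟩
  -- `γ • y₁ = θ y₂`, i.e. `γ⁻¹ • θ y₂ = y₁`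
  have h : γ⁻¹ • θ.hom.app Y (Fe₂.map ψ.hom (α₂.inv.app X x)) =
      Fe₁.map ψ.hom (α₁.inv.app X x) := by
    rw [inv_smul_eq_iff]
    exact hγ.symm
  rw [smul_frame_point_eq_iff] at h
  set k := Aut.autMulEquivOfIso α₁ (pi1Map b Fe₁ γ⁻¹) with hk
  set t := SemiGraphOfAnabelioids.transportAut α₂ (Functor.isoWhiskerLeft b θ ≪≫ α₁)
  refine ht k⁻¹ (Subgroup.inv_mem _ ⟨γ⁻¹, rfl⟩) (k * t) (by rwa [MulAction.mem_stabilizer_iff]) ?_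
  rw [← mul_assoc, inv_mul_cancel, one_mul]

end Frame

/-! ### Part B. The covering: clause (ii) of branch alignment -/

namespace SemiGraphOfAnabelioids

namespace Hom

variable {𝒢 𝒢' : SemiGraphOfAnabelioids.{v₁, u₁, u}} {φ : Hom 𝒢' 𝒢}

/-- **Branch alignment (ii) ⇒ the two edge points lie in different `Π_e`-orbits.**  Let `φ` be
branch-aligned, `v′` a vertex with basepoint `F′`, `b′₁ ≠ b′₂` two branches at `v′` over `b` (at
`v = φ v′`, of the edge `e`), with edge basepoints `F_{e′ᵢ}` and frames `α′ᵢ`, and let `x ∈ F(A_v)`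
(`F := φ_{v′}^* ⋙ F′`) have `Π_v`-stabiliser `ι(Π_{v′})` — the GLOBAL base point.  Then for every
identification `θ` of the two induced basepoints of `𝒢_e`, the point `θ(x^e(b′₂))` is not in the
`Π_e`-orbit of `x^e(b′₁)`, where `x^e(b′ᵢ) := F_{e,i}(ψ^A_b)(alignIsoᵢ⁻¹ x) ∈ F_{e,i}(A_e)` are the edge
points of abc-iut-f-161's `EdgeAlignedStabilizers`. [cite: MochizukiSemiAnbd2006, Def. 2.2(i) p.23] -/
theorem IsBranchAligned.edgePoint_not_mem_orbit (hal : φ.IsBranchAligned) (v' : 𝒢'.graph.Vertex)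
    (F' : 𝒢'.V v' ⥤ FintypeCat.{v₁}) [FiberFunctor F'] (b : 𝒢.graph.Branch)
    (b'₁ b'₂ : 𝒢'.graph.Branch) (h₁ : 𝒢'.graph.abuts b'₁ = some v') (h₂ : 𝒢'.graph.abuts b'₂ = some v')
    (p₁ : φ.base.branchMap b'₁ = b) (p₂ : φ.base.branchMap b'₂ = b) (hne : b'₁ ≠ b'₂)
    (Fe'₁ : 𝒢'.E (𝒢'.graph.edgeOf b'₁) ⥤ FintypeCat.{v₁}) [FiberFunctor Fe'₁]
    (α'₁ : (𝒢'.pull b'₁ v' h₁).pullback ⋙ Fe'₁ ≅ F')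
    (Fe'₂ : 𝒢'.E (𝒢'.graph.edgeOf b'₂) ⥤ FintypeCat.{v₁}) [FiberFunctor Fe'₂]
    (α'₂ : (𝒢'.pull b'₂ v' h₂).pullback ⋙ Fe'₂ ≅ F')
    (θ : (φ.φE (𝒢'.graph.edgeOf b'₂) (𝒢.graph.edgeOf b)
          ((φ.base.edgeOf_branchMap b'₂).symm.trans (congrArg 𝒢.graph.edgeOf p₂))).pullback ⋙ Fe'₂ ≅
        (φ.φE (𝒢'.graph.edgeOf b'₁) (𝒢.graph.edgeOf b)
          ((φ.base.edgeOf_branchMap b'₁).symm.trans (congrArg 𝒢.graph.edgeOf p₁))).pullback ⋙ Fe'₁)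
    {A : 𝒢.BObj} (x : ((φ.φV v').pullback ⋙ F').obj (A.S (φ.base.vertexMap v')))
    (hx : (pi1Map (φ.φV v').pullback F').range =
      MulAction.stabilizer (Aut ((φ.φV v').pullback ⋙ F')) x) :
    θ.hom.app (A.T (𝒢.graph.edgeOf b))
        (((φ.φE (𝒢'.graph.edgeOf b'₂) (𝒢.graph.edgeOf b)
            ((φ.base.edgeOf_branchMap b'₂).symm.trans (congrArg 𝒢.graph.edgeOf p₂))).pullback ⋙ Fe'₂).map
          (A.ψ b (φ.base.vertexMap v') (p₂ ▸ φ.base.abuts_branchMap b'₂ v' h₂)).hom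
          ((φ.alignIso b'₂ v' h₂ b p₂ F' Fe'₂ α'₂).inv.app (A.S (φ.base.vertexMap v')) x)) ∉
      MulAction.orbit (Aut ((φ.φE (𝒢'.graph.edgeOf b'₁) (𝒢.graph.edgeOf b)
            ((φ.base.edgeOf_branchMap b'₁).symm.trans (congrArg 𝒢.graph.edgeOf p₁))).pullback ⋙ Fe'₁))
        (((φ.φE (𝒢'.graph.edgeOf b'₁) (𝒢.graph.edgeOf b)
            ((φ.base.edgeOf_branchMap b'₁).symm.trans (congrArg 𝒢.graph.edgeOf p₁))).pullback ⋙ Fe'₁).map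
          (A.ψ b (φ.base.vertexMap v') (p₁ ▸ φ.base.abuts_branchMap b'₁ v' h₁)).hom
          ((φ.alignIso b'₁ v' h₁ b p₁ F' Fe'₁ α'₁).inv.app (A.S (φ.base.vertexMap v')) x)) := by
  haveI : FiberFunctor ((φ.φE (𝒢'.graph.edgeOf b'₁) (𝒢.graph.edgeOf b)
      ((φ.base.edgeOf_branchMap b'₁).symm.trans (congrArg 𝒢.graph.edgeOf p₁))).pullback ⋙ Fe'₁) :=
    fiberFunctor_comp_of_exact _ Fe'₁
  refine not_mem_orbit_of_transport
    (𝒢.pull b (φ.base.vertexMap v') (p₁ ▸ φ.base.abuts_branchMap b'₁ v' h₁)).pullback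
    (φ.alignIso b'₁ v' h₁ b p₁ F' Fe'₁ α'₁) (φ.alignIso b'₂ v' h₂ b p₂ F' Fe'₂ α'₂) θ
    (A.ψ b (φ.base.vertexMap v') (p₁ ▸ φ.base.abuts_branchMap b'₁ v' h₁)) x ?_
  intro β hβ s hs
  rw [← hx] at hs
  obtain ⟨u, rfl⟩ := hs
  exact (hal v' F' b).2 b'₁ b'₂ h₁ h₂ p₁ p₂ hne Fe'₁ α'₁ Fe'₂ α'₂ θ β hβ u

/-- **(T-β): distinct branches over `b` ⇒ distinct components of `A_e`** ([SemiAnbd] Def. 2.2 (i),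
p. 23: the branches of `𝒢_A` at `v′` over `b` are in bijection with the components of `b^*(P) ⊆ A_e`).
In the situation of `edgePoint_not_mem_orbit`, the connected components `P₁, P₂` of `A_e` carrying the
two edge points (each read in its own fibre functor) are different (components = orbits,
`Anabelioids.range_map_arrow_eq_orbit`). [cite: MochizukiSemiAnbd2006, Def. 2.2(i) p.23] -/
theorem IsBranchAligned.component_ne_of_branch_ne (hal : φ.IsBranchAligned) (v' : 𝒢'.graph.Vertex)
    (F' : 𝒢'.V v' ⥤ FintypeCat.{v₁}) [FiberFunctor F'] (b : 𝒢.graph.Branch)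
    (b'₁ b'₂ : 𝒢'.graph.Branch) (h₁ : 𝒢'.graph.abuts b'₁ = some v') (h₂ : 𝒢'.graph.abuts b'₂ = some v')
    (p₁ : φ.base.branchMap b'₁ = b) (p₂ : φ.base.branchMap b'₂ = b) (hne : b'₁ ≠ b'₂)
    (Fe'₁ : 𝒢'.E (𝒢'.graph.edgeOf b'₁) ⥤ FintypeCat.{v₁}) [FiberFunctor Fe'₁]
    (α'₁ : (𝒢'.pull b'₁ v' h₁).pullback ⋙ Fe'₁ ≅ F')
    (Fe'₂ : 𝒢'.E (𝒢'.graph.edgeOf b'₂) ⥤ FintypeCat.{v₁}) [FiberFunctor Fe'₂]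
    (α'₂ : (𝒢'.pull b'₂ v' h₂).pullback ⋙ Fe'₂ ≅ F')
    (θ : (φ.φE (𝒢'.graph.edgeOf b'₂) (𝒢.graph.edgeOf b)
          ((φ.base.edgeOf_branchMap b'₂).symm.trans (congrArg 𝒢.graph.edgeOf p₂))).pullback ⋙ Fe'₂ ≅
        (φ.φE (𝒢'.graph.edgeOf b'₁) (𝒢.graph.edgeOf b)
          ((φ.base.edgeOf_branchMap b'₁).symm.trans (congrArg 𝒢.graph.edgeOf p₁))).pullback ⋙ Fe'₁)
    {A : 𝒢.BObj} (x : ((φ.φV v').pullback ⋙ F').obj (A.S (φ.base.vertexMap v')))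
    (hx : (pi1Map (φ.φV v').pullback F').range =
      MulAction.stabilizer (Aut ((φ.φV v').pullback ⋙ F')) x)
    (P₁ P₂ : π₀Obj (A.T (𝒢.graph.edgeOf b)))
    (hP₁ : (((φ.φE (𝒢'.graph.edgeOf b'₁) (𝒢.graph.edgeOf b)
            ((φ.base.edgeOf_branchMap b'₁).symm.trans (congrArg 𝒢.graph.edgeOf p₁))).pullback ⋙ Fe'₁).map
          (A.ψ b (φ.base.vertexMap v') (p₁ ▸ φ.base.abuts_branchMap b'₁ v' h₁)).hom
          ((φ.alignIso b'₁ v' h₁ b p₁ F' Fe'₁ α'₁).inv.app (A.S (φ.base.vertexMap v')) x)) ∈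
      Set.range (((φ.φE (𝒢'.graph.edgeOf b'₁) (𝒢.graph.edgeOf b)
            ((φ.base.edgeOf_branchMap b'₁).symm.trans (congrArg 𝒢.graph.edgeOf p₁))).pullback ⋙ Fe'₁).map
        P₁.1.arrow))
    (hP₂ : (((φ.φE (𝒢'.graph.edgeOf b'₂) (𝒢.graph.edgeOf b)
            ((φ.base.edgeOf_branchMap b'₂).symm.trans (congrArg 𝒢.graph.edgeOf p₂))).pullback ⋙ Fe'₂).map
          (A.ψ b (φ.base.vertexMap v') (p₂ ▸ φ.base.abuts_branchMap b'₂ v' h₂)).hom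
          ((φ.alignIso b'₂ v' h₂ b p₂ F' Fe'₂ α'₂).inv.app (A.S (φ.base.vertexMap v')) x)) ∈
      Set.range (((φ.φE (𝒢'.graph.edgeOf b'₂) (𝒢.graph.edgeOf b)
            ((φ.base.edgeOf_branchMap b'₂).symm.trans (congrArg 𝒢.graph.edgeOf p₂))).pullback ⋙ Fe'₂).map
        P₂.1.arrow)) :
    P₁ ≠ P₂ := by
  -- notation for the two fibre functors of `𝒢_e`
  let Fe₁ := (φ.φE (𝒢'.graph.edgeOf b'₁) (𝒢.graph.edgeOf b)
    ((φ.base.edgeOf_branchMap b'₁).symm.trans (congrArg 𝒢.graph.edgeOf p₁))).pullback ⋙ Fe'₁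
  let Fe₂ := (φ.φE (𝒢'.graph.edgeOf b'₂) (𝒢.graph.edgeOf b)
    ((φ.base.edgeOf_branchMap b'₂).symm.trans (congrArg 𝒢.graph.edgeOf p₂))).pullback ⋙ Fe'₂
  haveI : FiberFunctor Fe₁ := fiberFunctor_comp_of_exact _ Fe'₁
  intro hP
  subst hP
  have hno := IsBranchAligned.edgePoint_not_mem_orbit hal v' F' b b'₁ b'₂ h₁ h₂ p₁ p₂ hne Fe'₁ α'₁
    Fe'₂ α'₂ θ x hx
  apply hno
  -- transport the membership of the second point along `θ` (naturality), then components = orbits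
  rw [← range_map_arrow_eq_orbit Fe₁ P₁ hP₁]
  obtain ⟨z, hz⟩ := hP₂
  refine ⟨θ.hom.app _ z, ?_⟩
  rw [← hz]
  exact (FunctorToFintypeCat.naturality Fe₂ Fe₁ θ.hom P₁.1.arrow z).symm

end Hom

end SemiGraphOfAnabelioids

end Literature.AnabelianGeometry.SemiGraphs
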